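import Mathlib.Analysis.SpecialFunctions.JapaneseBracket
import Mathlib.MeasureTheory.Measure.Hausdorff
import Literature.Analysis.FluidPDE.SelfSimilarLiouville
import Literature.Analysis.FluidPDE.LocalTypeI
import HarnessLib

/-!
# Tsai's theorem on self-similar singularities under local energy estimates: the reduction

Trunk T-FLUID (`Literature/Analysis/FluidPDE`), family NS, statement **ns.S21**; proofs layer
for the named fact `Literature.Analysis.FluidPDE.tsai_selfsimilar_local_energy` of
`Literature/Analysis/FluidPDE/SelfSimilarLiouville.lean` (T.-P. Tsai, *On Leray's self-similar
solutions of the Navier–Stokes equations satisfying local energy estimates*, Arch. Rational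
Mech. Anal. 143 (1998) 29–51, **Theorem 2**, p. 31).

Physical space is `ℝ³ = EuclideanSpace ℝ (Fin 3)`, velocities are `u : ℝ → ℝ³ → ℝ³` (time
first), `u = Fluid.lerayBackward a T U` is Leray's backward self-similar field
`u(t, x) = λ(t) U(λ(t) x)`, `λ(t) = (2a(T - t))^{-1/2}`, with profile `U` and putative
singularity at `(T, 0)` (Tsai 1998, (1.2)), and `Q_r(T, x) = (T - r², T) × B_r(x)` is the
accepted backward parabolic cylinder `Fluid.parabolicCylinder r (T, x)`.

## The printed proof and what this file does

Tsai proves Theorem 2 in §4–5 as follows (p. 47, "To finish the proof of Theorem 2 … The first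
way"):

1. **Lemma 4.1** (p. 46). If `u` is a weak solution of Navier–Stokes in
   `Q₁ = Q₁(0, T) = B₁(0) × (T - 1, T)` of the self-similar form (1.2)₁ satisfying the local
   energy estimates (1.4) there, then `u` is smooth and there is a smooth pressure
   `p ∈ L^{5/3}(Q₁)` of the form (1.2)₂ (namely `p = λ² P̃(λx)` with `P̃ = RᵢRⱼ(UᵢUⱼ)` in the
   weighted space `L^{5/3}_w`, `w = |y|^{-5/3}` an `A_{5/3}` weight) such that `(u, p)` is a
   *suitable weak solution* in `Q₁` in the sense of Caffarelli–Kohn–Nirenberg.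
2. **Lemma 4.2** (p. 46; Caffarelli–Kohn–Nirenberg 1982, Proposition 2 with the backward
   cylinders `Q_r(x, t)` in place of the centred `Q*_r(x, t)`) and the remark following it: for a
   suitable weak solution in a parabolic cylinder, *the singular set at the top of the cylinder
   has one-dimensional Hausdorff measure zero* (the covering argument of CKN 1982, proof of
   Theorem B, p. 807).
3. **Corollary 4.3** (pp. 46–47). Hence `U(y) = O(|y|⁻¹)` as `|y| → ∞`: otherwise there are
   `yₖ`, `|yₖ| → ∞`, with `|U(yₖ)| |yₖ| > k`, the directions `yₖ/|yₖ|` accumulate at some `x*`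
   on the unit sphere, and by self-similarity `u` is unbounded in every `Q_r(σ x*, T)`,
   `0 < σ < 1`: the top of the cylinder contains a singular segment, of positive
   one-dimensional Hausdorff measure — a contradiction.
4. (p. 47) Since `U` is smooth, `U ∈ L^q(ℝ³)` for `q > 3` by Corollary 4.3, and **Theorem 1**
   (`U ∈ L^q`, `3 < q < ∞` ⟹ `U ≡ 0`; the tree's named fact `Literature.Analysis.FluidPDE.tsai_selfsimilar`) gives
   `U ≡ 0`.

Steps 1 and 2 rest on theories Mathlib does not have (Calderón–Zygmund operators on `A_p`
weighted spaces; the Caffarelli–Kohn–Nirenberg ε-regularity theory). They are vendored here as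
the **named facts** `tsai1998_lemma41` and `tsai1998_top_singular_null` (statements below, as
printed, in the tree's vocabulary `Fluid.IsSuitableWeakSolutionOn`,
`Fluid.HasWeakSpatialGradientOn`, `NS.IsBackwardSingularPoint`, `μH[1]`). Steps 3 and 4 are
**proved**: `tsai1998_corollary43` (the contradiction argument, verbatim: compactness of the
unit sphere, the self-similar points `(T - σ²/(2a|yₖ|²), σ yₖ/|yₖ|) ∈ Q_r(T, σ x*)` at which
`|u| = |yₖ| |U(yₖ)| / σ > k/σ`, continuity of `u` below the blow-up time to pass from pointwise to
essential unboundedness, and `μH[1]` of the segment `{σ x* : 0 < σ < ρ}` equals `ρ > 0` by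
Mathlib's `hausdorffMeasure_smul_right_image`), `memLp_of_norm_mul_norm_le` (a continuous field
with `|y| |U(y)| ≤ C` for `|y| ≥ R` lies in `L^q(ℝ³)` for every `3 < q < ∞`, by comparison with
`(1 + |y|)^{-q}`, Mathlib's `integrable_one_add_norm`), and the assembly
`tsai_selfsimilar_local_energy_of_tsai_selfsimilar`:

  `tsai_selfsimilar → tsai1998_lemma41 → tsai1998_top_singular_null →
    tsai_selfsimilar_local_energy`.

Moreover Lemma 4.2 *itself* (the backward ε-regularity criterion) is vendored as
`tsai1998_lemma42`, and the covering argument of CKN's Theorem B at the top time, which Tsai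
leaves to the reader, is **proved**: `tsai1998_top_singular_null_of_lemma42 :
tsai1998_lemma42 → tsai1998_top_singular_null` (Vitali's covering lemma for the base balls in
`ℝ³`, Mathlib `Vitali.exists_disjoint_subfamily_covering_enlargement_closedBall`, countable
additivity of the finite measure `|∇u|² dx dt ⌊ Q_ρ`, and
`Measure.hausdorffMeasure_le_liminf_tsum`). The net reduction is
`tsai_selfsimilar_local_energy_of_lemmas : tsai_selfsimilar → tsai1998_lemma41 →
tsai1998_lemma42 → tsai_selfsimilar_local_energy`: the remaining inputs are exactly Tsai's
Theorem 1, Lemma 4.1 and Lemma 4.2. Once they are discharged,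
`tsai_selfsimilar_local_energy_holds` is this implication applied to their `_holds` theorems.

## Design notes

* **The cylinder `Q_ρ(0, T)` instead of `Q₁(0, T)`.** The vendored `tsai_selfsimilar_local_energy`
  assumes the local energy estimates on `B₁(0) × (t₀, T)` for *some* `t₀ < T` (see the module
  docstring of `SelfSimilarLiouville.lean`, "ns.S21"); these contain the estimates on the
  cylinder `Q_ρ(0, T)`, `ρ = min(1, √(T - t₀))`, by monotonicity of the integrals. Lemma 4.1 is
  therefore vendored for the cylinder `Q_ρ(0, T)` of any radius `ρ > 0`, which is Tsai's
  statement (`ρ = 1`) transported by the Navier–Stokes scaling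
  `u ↦ ρ u(ρ x, T + ρ²(t - T))`, `p ↦ ρ² p(ρ x, T + ρ²(t - T))`: this scaling maps `Q₁(0, T)`
  onto `Q_ρ(0, T)`, fixes every field of the form (1.2) with singularity at `(T, 0)`
  (`(ū)_r = ū`, Tsai 1998, p. 30), and preserves weak solutions, the local energy estimates and
  suitability (Caffarelli–Kohn–Nirenberg 1982, §2; the tree's
  `Fluid.IsSuitableWeakSolutionOn.stRescale`, `SuitableWeakRescaling.lean`). No change of
  variables is then needed in the proved part.
* **CKN's class on a cylinder.** Tsai's "suitable weak solution in `Q_r`" is CKN's (p. 33, (i)–(iv)):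
  the equations in `𝒟'(Q_r)`, the local energy estimates (1.4) *on the whole cylinder*
  (`u ∈ L^∞(T - r², T; L²(B_r))`, `∇u ∈ L²(Q_r)`), `p ∈ L^{5/4}(Q_r)`, and the generalized energy
  inequality. The accepted `Fluid.IsSuitableWeakSolutionOn Q ν f u p` (Lin 1998, Def. 1) only
  asks the integrability classes *locally* on the open set `Q` (compact `K ⊆ Q`) and has the
  pressure in `L^{3/2}_loc`. Regularity *at the top* `t = T` of the cylinder needs the classes up
  to the top, so both facts carry them explicitly and globally on the cylinder: an a.e.-in-time
  bound on `∫_{B_ρ} |u(t)|²` over `(T - ρ², T)`, a weak spatial gradient `G` of `u` on the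
  cylinder with `∫∫_{Q_ρ} |G|² < ∞`, and `p ∈ L^{5/3}(Q_ρ)` (Lemma 4.1's exponent) resp.
  `p ∈ L^{3/2}(Q_ρ)` (hypothesis of the top-regularity fact; on a bounded cylinder
  `L^{5/3} ⊆ L^{3/2} ⊆ L^{5/4}`, so this hypothesis is stronger than CKN's and the fact as
  vendored is implied by the printed one; the passage `5/3 → 3/2` is the proved
  `setLIntegral_rpow_le_measure_add`).
* **Singular points at the top.** "`u` is essentially bounded in `Q_{r₁}(x, t)` for some
  `r₁ > 0`" (Lemma 4.2) negated is the accepted backward notion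
  `NS.IsBackwardSingularPoint u (T, x)` (`LocalTypeI.lean`; Albritton–Barker 2019, §1):
  `‖u‖_{L^∞(Q_r(T, x))} = ∞` for every `r > 0`. Only values of `u` at times `t < T` enter, as in
  print ("it assumes the information only at times previous to `t`", p. 46); in particular the
  junk values `Fluid.lerayBackward a T U t = 0`, `t ≥ T`, are never seen.
* **`U` smooth.** In print `U` is a weak solution of Leray's system (1.3), smooth by elliptic
  regularity (p. 33); the accepted profile class `Fluid.IsLerayProfile ν a U P` is the pointwise
  `C²` class, for which `u = Fluid.lerayBackward a T U` is continuous on `{t < T} × ℝ³`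
  (`continuousAt_uncurry_lerayBackward`), all that steps 3–4 use.

## Mathlib / tree search

Mathlib (this pin): `MeasureTheory.Measure.hausdorffMeasure` with
`MeasureTheory.hausdorffMeasure_smul_right_image` (`μH[1]` of `{r • v : r ∈ s}`) and
`MeasureTheory.hausdorffMeasure_real`; `integrable_one_add_norm` (Japanese bracket);
`IsCompact.tendsto_subseq`, `isCompact_sphere`; `MeasureTheory.ae_le_eLpNormEssSup`;
`IsOpen.measure_pos`; `Vitali.exists_disjoint_subfamily_covering_enlargement_closedBall`,
`Set.PairwiseDisjoint.countable_of_nonempty_interior`, `MeasureTheory.measure_iUnion`,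
`MeasureTheory.tendsto_measure_iInter_atTop`, `Measure.hausdorffMeasure_le_liminf_tsum`,
`Filter.frequently_lt_of_lt_limsup`. Mathlib has no Navier–Stokes, ε-regularity, Muckenhoupt-weight or
Riesz-transform theory (`lean search` for `Riesz transform`, `Calderon`, `Muckenhoupt`,
`epsilon_regularity` finds only tree docstrings and the tree file below). Tree:
`Literature.Analysis.FluidPDE.tsai_selfsimilar`, `Literature.Analysis.FluidPDE.tsai_selfsimilar_local_energy` (`SelfSimilarLiouville.lean`),
`Literature.Analysis.FluidPDE.IsBackwardSingularPoint` (`LocalTypeI.lean`), `Fluid.IsSuitableWeakSolutionOn`,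
`Fluid.HasWeakSpatialGradientOn`, `Fluid.parabolicCylinder(Opens)` (`SuitableWeak.lean`),
`Fluid.lerayBackward`, `Fluid.IsLerayProfile` (`SelfSimilar.lean`),
`Literature.Analysis.FluidPDE.ckn_partial_regularity` / `ckn_epsilon_regularity` (`PartialRegularity.lean`: the
*interior*, centred-cylinder statements, which do not cover the top of a cylinder), and
`Literature.Analysis.FluidPDE.lemarieRieusset_epsilon_regularity` (`CKNEpsilonRegularity.lean`: Lemarié-Rieusset 2016,
Thm. 14.4, a one-scale ε-regularity criterion on *backward* cylinders in terms of
`∫∫ (|u|³ + |p|^{3/2})`, the natural first input of a future discharge of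
`tsai1998_top_singular_null`; the `μH[1]`-null conclusion needs the gradient form, CKN's
Proposition 2, and the covering argument of CKN's Theorem B).

## References

* T.-P. Tsai, *On Leray's self-similar solutions of the Navier–Stokes equations satisfying local
  energy estimates*, Arch. Rational Mech. Anal. 143 (1998) 29–51: Thm 2 (p. 31), §2 (p. 33),
  (4.1) and Lemma 4.1 (pp. 44–46), Lemma 4.2 and Corollary 4.3 (pp. 46–47), proof of Thm 2
  (p. 47) [Tsai1998].
* L. Caffarelli, R. Kohn, L. Nirenberg, *Partial regularity of suitable weak solutions of the
  Navier–Stokes equations*, Comm. Pure Appl. Math. 35 (1982) 771–831: §2, Proposition 2,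
  Theorem B and its proof (p. 807) [CaffarelliKohnNirenberg1982].
* D. Albritton, T. Barker, *On local Type I singularities of the Navier–Stokes equations and
  Liouville theorems*, J. Math. Fluid Mech. 21 (2019), §1 (backward singular points)
  [AlbrittonBarker2019].
-/

noncomputable section

open MeasureTheory Set Function Filter Topology TopologicalSpace Metric
open scoped NNReal ENNReal InnerProductSpace RealInnerProductSpace

namespace Literature.Analysis.FluidPDE

/-- Local notation for physical space `ℝ³ = EuclideanSpace ℝ (Fin 3)`. -/
local notation "ℝ³" => EuclideanSpace ℝ (Fin 3)

/-! ## The two inputs from Tsai 1998, §4 (named facts) -/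

/-- **Tsai 1998, Lemma 4.1** (p. 46: "Let `u` be a weak solution of (1.1) in `Q₁` satisfying the
local energy estimates (1.4). If `u` is of the form (1.2)₁, then `u` is smooth, and there is a
smooth function `p ∈ L^{5/3}(Q₁)` of the form (1.2)₂ such that `(u, p)` is a suitable weak
solution of (1.1) in `Q₁`"), rendered for the accepted `C²` profile class and for the cylinder
`Q_ρ(0, T) = (T - ρ², T) × B_ρ(0)` of any radius `ρ > 0` (Tsai's `Q₁(0, T)` is `ρ = 1`; the
general radius is its image under the Navier–Stokes scaling `u ↦ ρu(ρx, T + ρ²(t - T))`, which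
fixes self-similar fields centred at `(T, 0)` and preserves all clauses, module docstring). Let
`ν > 0`, `a > 0`, `ρ > 0`, let `(U, P)` solve Leray's profile system (`Fluid.IsLerayProfile`), and
let `u = Fluid.lerayBackward a T U` satisfy the local energy estimates (1.4) on `Q_ρ(0, T)`:
`sup_{T-ρ² < t < T} ∫_{B_ρ} |u(t)|² < ∞` and `∫_{T-ρ²}^{T} ∫_{B_ρ} |∇u|² < ∞` (classical gradient of
the `C²` slices, Frobenius norm). Then there are a pressure `p` and a weak spatial gradient `G`
of `u` on `Q_ρ(0, T)` such that `(u, p)` is a suitable weak solution on `Q_ρ(0, T)` with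
viscosity `ν` and zero force (`Fluid.IsSuitableWeakSolutionOn`: equations in `𝒟'`, local
classes, local energy inequality) which moreover lies in CKN's class *on the whole cylinder*:
`∫∫_{Q_ρ(0,T)} |G|² < ∞` and `p ∈ L^{5/3}(Q_ρ(0, T))`. (In print `p = λ² P̃(λ x)`,
`P̃ = RᵢRⱼ(UᵢUⱼ) ∈ L^{5/3}_w(ℝ³)`, `w = |y|^{-5/3}`; this explicit form is not recorded.)
[cite: Tsai1998, Lemma 4.1 (p. 46)] -/
def tsai1998_lemma41 : Prop :=
  ∀ {ν a T ρ : ℝ} (hν : 0 < ν) (ha : 0 < a) (hρ : 0 < ρ) {U : ℝ³ → ℝ³} {P : ℝ³ → ℝ}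
    (hprof : FluidPDE.IsLerayProfile ν a U P)
    (henergy : ∃ C : ℝ≥0, ∀ t ∈ Ioo (T - ρ ^ 2) T,
      ∫⁻ x in ball (0 : ℝ³) ρ, ‖FluidPDE.lerayBackward a T U t x‖ₑ ^ 2 ≤ C)
    (hgrad : ∫⁻ t in Ioo (T - ρ ^ 2) T, ∫⁻ x in ball (0 : ℝ³) ρ,
      ENNReal.ofReal (FluidPDE.frobeniusNormSq (fderiv ℝ (FluidPDE.lerayBackward a T U t) x)) < ∞),
    ∃ (p : ℝ → ℝ³ → ℝ) (G : ℝ → ℝ³ → ℝ³ →L[ℝ] ℝ³),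
      FluidPDE.IsSuitableWeakSolutionOn (FluidPDE.parabolicCylinderOpens ρ (T, (0 : ℝ³))) ν 0
          (FluidPDE.lerayBackward a T U) p ∧
      FluidPDE.HasWeakSpatialGradientOn (FluidPDE.parabolicCylinderOpens ρ (T, (0 : ℝ³)))
          (FluidPDE.lerayBackward a T U) G ∧
      ∫⁻ z in FluidPDE.parabolicCylinder ρ (T, (0 : ℝ³)),
          ENNReal.ofReal (FluidPDE.frobeniusNormSq (G z.1 z.2)) < ∞ ∧
      ∫⁻ z in FluidPDE.parabolicCylinder ρ (T, (0 : ℝ³)), ‖p z.1 z.2‖ₑ ^ (5 / 3 : ℝ) < ∞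

/-- **Tsai 1998, Lemma 4.2 and the remark following it** (p. 46). Lemma 4.2 is
Caffarelli–Kohn–Nirenberg's ε-regularity criterion (CKN 1982, Proposition 2) with the backward
cylinders `Q_r(x, t)` in place of the centred `Q*_r(x, t)`: "Let `(u, p)` be a suitable weak
solution of (1.1). There is an absolute constant `ε₄ > 0` such that, if
`limsup_{r → 0⁺} r⁻¹ ∫_{Q_r(x,t)} |∇u|² ≤ ε₄`, then `u` is essentially bounded in `Q_{r₁}(x, t)`
for some `r₁ > 0`"; and, as Tsai records next, "as in the proof of Theorem B in [CKN, p. 807],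
this lemma implies that the singular set at the top of the parabolic cylinder also has
one-dimensional Hausdorff measure zero." Vendored is this consequence. Let `ν > 0`, `ρ > 0`, and
let `(u, p)` be a suitable weak solution of Navier–Stokes (zero force) on the cylinder
`Q_ρ(x₀, T) = (T - ρ², T) × B_ρ(x₀)` in CKN's class on the whole cylinder (Tsai 1998, p. 33,
(i)–(iv); CKN 1982, (2.1)–(2.5)): the accepted `Fluid.IsSuitableWeakSolutionOn` together with
`u ∈ L^∞(T - ρ², T; L²(B_ρ(x₀)))`, a weak spatial gradient `G` of `u` with `∫∫_{Q_ρ} |G|² < ∞`, and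
`p ∈ L^{3/2}(Q_ρ(x₀, T))` (stronger than CKN's `L^{5/4}`, module docstring). Then the set of
`x ∈ B_ρ(x₀)` such that `(T, x)` is a (backward) singular point — `u` is essentially unbounded on
`Q_r(T, x)` for every `r > 0`, `NS.IsBackwardSingularPoint u (T, x)` — has one-dimensional
Hausdorff measure zero (`μH[1]` on `ℝ³`).
[cite: Tsai1998, Lemma 4.2 and the following remark (p. 46)] -/
def tsai1998_top_singular_null : Prop :=
  ∀ {ν ρ T : ℝ} {x₀ : ℝ³} (hν : 0 < ν) (hρ : 0 < ρ) {u : ℝ → ℝ³ → ℝ³} {p : ℝ → ℝ³ → ℝ}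
    (hsuit : FluidPDE.IsSuitableWeakSolutionOn (FluidPDE.parabolicCylinderOpens ρ (T, x₀)) ν 0 u p)
    (henergy : ∃ C : ℝ≥0, ∀ᵐ t : ℝ, t ∈ Ioo (T - ρ ^ 2) T →
      ∫⁻ x in ball x₀ ρ, ‖u t x‖ₑ ^ 2 ≤ C)
    (hgrad : ∃ G : ℝ → ℝ³ → ℝ³ →L[ℝ] ℝ³,
      FluidPDE.HasWeakSpatialGradientOn (FluidPDE.parabolicCylinderOpens ρ (T, x₀)) u G ∧
      ∫⁻ z in FluidPDE.parabolicCylinder ρ (T, x₀),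
        ENNReal.ofReal (FluidPDE.frobeniusNormSq (G z.1 z.2)) < ∞)
    (hp : ∫⁻ z in FluidPDE.parabolicCylinder ρ (T, x₀), ‖p z.1 z.2‖ₑ ^ (3 / 2 : ℝ) < ∞),
    μH[1] {x ∈ ball x₀ ρ | IsBackwardSingularPoint u (T, x)} = 0

/-! ## Elementary lemmas -/

/-- A backward parabolic cylinder in `ℝ × ℝ³` has finite Lebesgue measure
(`|Q_r| = r² · |B_r|`). [folklore] -/
theorem volume_parabolicCylinder_lt_top (r : ℝ) (z : ℝ × ℝ³) :
    volume (FluidPDE.parabolicCylinder r z) < ∞ := by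
  rw [FluidPDE.parabolicCylinder, Measure.volume_eq_prod, Measure.prod_prod]
  exact ENNReal.mul_lt_top (by simp [Real.volume_Ioo]) measure_ball_lt_top

/-- On a set of finite measure a smaller power costs at most the measure:
`∫_s f^{r₁} ≤ μ(s) + ∫_s f^{r₂}` for `0 ≤ r₁ ≤ r₂` (pointwise `x^{r₁} ≤ 1 + x^{r₂}`). Used to pass
from `p ∈ L^{5/3}(Q)` to `p ∈ L^{3/2}(Q)`. [folklore] -/
theorem setLIntegral_rpow_le_measure_add {α : Type*} [MeasurableSpace α] (μ : Measure α)
    (s : Set α) (f : α → ℝ≥0∞) {r₁ r₂ : ℝ} (hr₁ : 0 ≤ r₁) (h : r₁ ≤ r₂) :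
    ∫⁻ x in s, f x ^ r₁ ∂μ ≤ μ s + ∫⁻ x in s, f x ^ r₂ ∂μ := by
  calc ∫⁻ x in s, f x ^ r₁ ∂μ ≤ ∫⁻ x in s, (1 + f x ^ r₂) ∂μ := lintegral_mono fun x => ?_
    _ = μ s + ∫⁻ x in s, f x ^ r₂ ∂μ := by
      rw [lintegral_add_left measurable_const, setLIntegral_const, one_mul]
  rcases le_total (f x) 1 with hx | hx
  · exact (ENNReal.rpow_le_one hx hr₁).trans le_self_add
  · exact (ENNReal.rpow_le_rpow_of_exponent_le hx h).trans le_add_self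

/-- Leray's backward field `u(t, x) = λ(t) U(λ(t) x)` is jointly continuous below the blow-up
time: for a continuous profile `U` and `a > 0`, `uncurry (Fluid.lerayBackward a T U)` is
continuous at every `(t, x)` with `t < T` (there `λ(t) = (2a(T - t))^{-1/2}` is a continuous
function of `t`). [folklore] -/
theorem continuousAt_uncurry_lerayBackward {a T : ℝ} (ha : 0 < a) {U : ℝ³ → ℝ³}
    (hU : Continuous U) {z : ℝ × ℝ³} (hz : z.1 < T) :
    ContinuousAt (uncurry (FluidPDE.lerayBackward a T U)) z := by
  have hc : ContinuousAt (fun w : ℝ × ℝ³ => (Real.sqrt (2 * a * (T - w.1)))⁻¹) z := by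
    refine ContinuousAt.inv₀ ?_ (Real.sqrt_pos.2 ?_).ne'
    · exact (by fun_prop : Continuous fun w : ℝ × ℝ³ => Real.sqrt (2 * a * (T - w.1))).continuousAt
    · exact mul_pos (mul_pos two_pos ha) (sub_pos.2 hz)
  have h2 : ContinuousAt (fun w : ℝ × ℝ³ => U ((Real.sqrt (2 * a * (T - w.1)))⁻¹ • w.2)) z :=
    hU.continuousAt.comp' (hc.smul continuousAt_snd)
  have heq : uncurry (FluidPDE.lerayBackward a T U) = fun w : ℝ × ℝ³ =>
      (Real.sqrt (2 * a * (T - w.1)))⁻¹ • U ((Real.sqrt (2 * a * (T - w.1)))⁻¹ • w.2) := by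
    funext w
    rfl
  rw [heq]
  exact hc.smul h2

/-- The self-similar field at scale `L > 0`: at the time `t = T - (2aL²)⁻¹`, where `λ(t) = L`,
`u(t, x) = L U(L x)` (Tsai 1998, proof of Corollary 4.3: "let `tₖ` be the time such that
`λ(tₖ) σ = |yₖ|`"). [cite: Tsai1998, proof of Corollary 4.3 (p. 47)] -/
theorem lerayBackward_apply_of_scale {a T L : ℝ} (ha : 0 < a) (hL : 0 < L) (U : ℝ³ → ℝ³)
    (x : ℝ³) : FluidPDE.lerayBackward a T U (T - (2 * a * L ^ 2)⁻¹) x = L • U (L • x) := by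
  have h1 : 2 * a * (T - (T - (2 * a * L ^ 2)⁻¹)) = (L ^ 2)⁻¹ := by
    rw [sub_sub_cancel]
    field_simp
  have h2 : Real.sqrt ((L ^ 2)⁻¹) = L⁻¹ := by
    rw [Real.sqrt_inv, Real.sqrt_sq hL.le]
  simp only [FluidPDE.lerayBackward_apply, h1, h2, inv_inv]

/-- From pointwise to essential unboundedness: if in every backward cylinder `Q_r(z₀)` the field
takes, at points of continuity, arbitrarily large values, then `z₀` is a backward singular point
(`‖u‖_{L^∞(Q_r(z₀))} = ∞` for all `r > 0`): around a continuity point where `|u| > M` there is an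
open, hence non-null, subset of `Q_r(z₀)` on which `|u| > M`. [folklore] -/
theorem isBackwardSingularPoint_of_forall_exists_continuousAt {u : ℝ → ℝ³ → ℝ³} {z₀ : ℝ × ℝ³}
    (h : ∀ r : ℝ, 0 < r → ∀ M : ℝ, ∃ z ∈ FluidPDE.parabolicCylinder r z₀,
      ContinuousAt (uncurry u) z ∧ M < ‖uncurry u z‖) :
    IsBackwardSingularPoint u z₀ := by
  intro r hr
  by_contra hne
  set μ : Measure (ℝ × ℝ³) := volume.restrict (FluidPDE.parabolicCylinder r z₀) with hμ
  set A : ℝ≥0∞ := eLpNorm (uncurry u) ∞ μ with hA_def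
  have hae : ∀ᵐ z ∂μ, ‖uncurry u z‖ₑ ≤ A := by
    rw [hA_def, eLpNorm_exponent_top]
    exact ae_le_eLpNormEssSup
  obtain ⟨z, hz, hcont, hM⟩ := h r hr A.toReal
  have hpos : 0 < ‖uncurry u z‖ := lt_of_le_of_lt ENNReal.toReal_nonneg hM
  have hzA : A < ‖uncurry u z‖ₑ := by
    rw [← ENNReal.ofReal_toReal hne, ← ofReal_norm]
    exact (ENNReal.ofReal_lt_ofReal_iff hpos).2 hM
  have h1 : {w : ℝ × ℝ³ | A < ‖uncurry u w‖ₑ} ∈ 𝓝 z :=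
    (continuous_enorm.continuousAt.comp' hcont).preimage_mem_nhds (Ioi_mem_nhds hzA)
  have h2 : FluidPDE.parabolicCylinder r z₀ ∈ 𝓝 z := (FluidPDE.isOpen_parabolicCylinder r z₀).mem_nhds hz
  obtain ⟨O, hOsub, hOopen, hzO⟩ := _root_.mem_nhds_iff.1 (inter_mem h1 h2)
  have hOpos : 0 < volume O := hOopen.measure_pos volume ⟨z, hzO⟩
  have hO_le : μ O ≤ μ {w | ¬ ‖uncurry u w‖ₑ ≤ A} :=
    measure_mono fun w hw => not_le.2 (hOsub hw).1
  have hzero : μ {w | ¬ ‖uncurry u w‖ₑ ≤ A} = 0 := ae_iff.1 hae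
  have hμO : μ O = volume O := by
    rw [hμ, Measure.restrict_apply hOopen.measurableSet,
      inter_eq_left.2 fun w hw => (hOsub hw).2]
  have : μ O = 0 := le_antisymm (hO_le.trans hzero.le) (zero_le)
  rw [hμO] at this
  exact hOpos.ne' this

/-- **Decay `O(|y|⁻¹)` gives `L^q`, `q > 3`** (Tsai 1998, p. 47: "since `U` is smooth,
`U ∈ L^q(ℝ³)` for `q > 3` by Lemma 4.1 and Corollary 4.3"). A continuous field `U` on `ℝ³` with
`|y| |U(y)| ≤ C` for `|y| ≥ R` belongs to `L^q(ℝ³)` for every `3 < q < ∞`: it is bounded by a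
multiple of `(1 + |y|)⁻¹`, and `(1 + |y|)^{-q}` is integrable on `ℝ³` for `q > 3`
(Mathlib `integrable_one_add_norm`). [cite: Tsai1998, proof of Theorem 2 (p. 47)] -/
theorem memLp_of_norm_mul_norm_le {U : ℝ³ → ℝ³} (hU : Continuous U) {C R : ℝ}
    (hdecay : ∀ y : ℝ³, R ≤ ‖y‖ → ‖y‖ * ‖U y‖ ≤ C) {q : ℝ≥0∞} (hq : 3 < q) (hq' : q < ∞) :
    MemLp U q volume := by
  set R' : ℝ := max R 1 with hR'
  have hR'0 : 0 ≤ R' := zero_le_one.trans (le_max_right _ _)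
  obtain ⟨B, hB⟩ :=
    (isCompact_closedBall (0 : ℝ³) R').exists_bound_of_continuousOn hU.continuousOn
  have hB0 : 0 ≤ B := (norm_nonneg _).trans (hB 0 (mem_closedBall_self hR'0))
  set C' : ℝ := B * (1 + R') + 2 * |C| with hC'
  have hbound : ∀ y : ℝ³, ‖U y‖ ≤ C' * (1 + ‖y‖) ^ (-(1 : ℝ)) := by
    intro y
    rw [Real.rpow_neg (by positivity), Real.rpow_one, ← div_eq_mul_inv,
      le_div_iff₀ (by positivity)]
    rcases le_or_gt ‖y‖ R' with h | h
    · calc ‖U y‖ * (1 + ‖y‖) ≤ B * (1 + R') :=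
            mul_le_mul (hB y (mem_closedBall_zero_iff.2 h)) (by linarith) (by positivity) hB0
        _ ≤ C' := by rw [hC']; linarith [abs_nonneg C]
    · have hRy : R ≤ ‖y‖ := (le_max_left _ _).trans h.le
      have h1y : 1 ≤ ‖y‖ := (le_max_right _ _).trans h.le
      have hd : ‖y‖ * ‖U y‖ ≤ |C| := (hdecay y hRy).trans (le_abs_self C)
      have hUy : ‖U y‖ ≤ |C| := by
        calc ‖U y‖ = 1 * ‖U y‖ := (one_mul _).symm
          _ ≤ ‖y‖ * ‖U y‖ := mul_le_mul_of_nonneg_right h1y (norm_nonneg _)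
          _ ≤ |C| := hd
      calc ‖U y‖ * (1 + ‖y‖) = ‖U y‖ + ‖y‖ * ‖U y‖ := by ring
        _ ≤ |C| + |C| := add_le_add hUy hd
        _ ≤ C' := by rw [hC']; nlinarith [hB0, hR'0]
  have hq0 : q ≠ 0 := (lt_trans (by norm_num) hq).ne'
  have hqtop : q ≠ ∞ := hq'.ne
  have hq3 : (3 : ℝ) < q.toReal := by
    have h3 : (3 : ℝ≥0∞).toReal = 3 := by norm_num
    rw [← h3]
    exact (ENNReal.toReal_lt_toReal (by norm_num) hqtop).2 hq
  have hmeas : AEStronglyMeasurable (fun y : ℝ³ => C' * (1 + ‖y‖) ^ (-(1 : ℝ))) volume :=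
    Measurable.aestronglyMeasurable (by fun_prop)
  have hg : MemLp (fun y : ℝ³ => C' * (1 + ‖y‖) ^ (-(1 : ℝ))) q volume := by
    rw [← integrable_norm_rpow_iff hmeas hq0 hqtop]
    have hfin : (Module.finrank ℝ ℝ³ : ℝ) < q.toReal := by
      simpa [finrank_euclideanSpace] using hq3
    have hint := (integrable_one_add_norm (E := ℝ³) (μ := volume) hfin).const_mul
      (|C'| ^ q.toReal)
    refine hint.congr (ae_of_all _ fun y => ?_)
    have h1 : (0 : ℝ) ≤ (1 + ‖y‖) ^ (-(1 : ℝ)) := Real.rpow_nonneg (by positivity) _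
    simp only
    rw [norm_mul, Real.norm_eq_abs, Real.norm_of_nonneg h1, Real.mul_rpow (abs_nonneg _) h1,
      ← Real.rpow_mul (by positivity), neg_one_mul]
  exact hg.mono' hU.aestronglyMeasurable (ae_of_all _ hbound)

/-! ## Corollary 4.3 and Theorem 2 -/

/-- **Tsai 1998, Corollary 4.3** (pp. 46–47: "Let `(u, p)` be a suitable weak solution of the
Navier–Stokes equations (1.1) in `Q₁(0, T)`, and let `u` be of the form (1.2)₁. Then
`U(y) = O(|y|⁻¹)`"), here from the hypotheses of Theorem 2 via Lemma 4.1 (which supplies the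
suitable pressure) and the top-regularity consequence of Lemma 4.2, both taken as named facts.
The proof is Tsai's: if not, pick `yₖ` with `|yₖ| ≥ k + 1` and `|yₖ| |U(yₖ)| > k`; the directions
`yₖ/|yₖ|` have an accumulation point `x*` on the unit sphere; for `0 < σ < ρ` and `r > 0`, at the
time `tₖ = T - σ²/(2a|yₖ|²)` (so that `λ(tₖ) σ = |yₖ|`) the point `(tₖ, σ yₖ/|yₖ|)` lies in
`Q_r(T, σ x*)` for `k` large and `|u(tₖ, σ yₖ/|yₖ|)| = |yₖ| |U(yₖ)| / σ > k/σ`; `u` being continuous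
below `T`, it is essentially unbounded on `Q_r(T, σ x*)`, so the whole segment
`{σ x* : 0 < σ < ρ} ⊆ B_ρ(0)` consists of singular points at the top of `Q_ρ(0, T)`; but its
`μH[1]`-measure is `ρ > 0`. [cite: Tsai1998, Corollary 4.3 (pp. 46–47)] -/
theorem tsai1998_corollary43 (h41 : tsai1998_lemma41) (h42 : tsai1998_top_singular_null)
    {ν a T t₀ : ℝ} (hν : 0 < ν) (ha : 0 < a) (ht₀ : t₀ < T) {U : ℝ³ → ℝ³} {P : ℝ³ → ℝ}
    (hprof : FluidPDE.IsLerayProfile ν a U P)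
    (henergy : ∃ C : ℝ≥0, ∀ t ∈ Ioo t₀ T,
      ∫⁻ x in ball (0 : ℝ³) 1, ‖FluidPDE.lerayBackward a T U t x‖ₑ ^ 2 ≤ C)
    (hgrad : ∫⁻ t in Ioo t₀ T, ∫⁻ x in ball (0 : ℝ³) 1,
      ENNReal.ofReal (FluidPDE.frobeniusNormSq (fderiv ℝ (FluidPDE.lerayBackward a T U t) x)) < ∞) :
    ∃ C R : ℝ, ∀ y : ℝ³, R ≤ ‖y‖ → ‖y‖ * ‖U y‖ ≤ C := by
  -- Step 0: the cylinder `Q_ρ(0, T) ⊆ (t₀, T) × B₁(0)`.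
  set ρ : ℝ := min 1 (Real.sqrt (T - t₀)) with hρ_def
  have hρ : 0 < ρ := lt_min one_pos (Real.sqrt_pos.2 (sub_pos.2 ht₀))
  have hρ1 : ρ ≤ 1 := min_le_left _ _
  have hρT : t₀ ≤ T - ρ ^ 2 := by
    have : ρ ^ 2 ≤ T - t₀ := by
      calc ρ ^ 2 ≤ Real.sqrt (T - t₀) ^ 2 := pow_le_pow_left₀ hρ.le (min_le_right _ _) 2
        _ = T - t₀ := Real.sq_sqrt (sub_pos.2 ht₀).le
    linarith
  have hI : Ioo (T - ρ ^ 2) T ⊆ Ioo t₀ T := Ioo_subset_Ioo_left hρT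
  have hB : ball (0 : ℝ³) ρ ⊆ ball 0 1 := ball_subset_ball hρ1
  -- Step 1: Lemma 4.1 on `Q_ρ(0, T)`.
  obtain ⟨C₀, hC₀⟩ := henergy
  have hC₀' : ∀ t ∈ Ioo (T - ρ ^ 2) T,
      ∫⁻ x in ball (0 : ℝ³) ρ, ‖FluidPDE.lerayBackward a T U t x‖ₑ ^ 2 ≤ C₀ :=
    fun t ht => (lintegral_mono_set hB).trans (hC₀ t (hI ht))
  have hgrad' : ∫⁻ t in Ioo (T - ρ ^ 2) T, ∫⁻ x in ball (0 : ℝ³) ρ,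
      ENNReal.ofReal (FluidPDE.frobeniusNormSq (fderiv ℝ (FluidPDE.lerayBackward a T U t) x)) < ∞ :=
    lt_of_le_of_lt ((lintegral_mono fun t => lintegral_mono_set hB).trans (lintegral_mono_set hI))
      hgrad
  obtain ⟨p, G, hsuit, hG, hGint, hp53⟩ := h41 hν ha hρ hprof ⟨C₀, hC₀'⟩ hgrad'
  -- Step 2: the top singular set of `Q_ρ(0, T)` is `μH[1]`-null.
  have hp32 : ∫⁻ z in FluidPDE.parabolicCylinder ρ (T, (0 : ℝ³)), ‖p z.1 z.2‖ₑ ^ (3 / 2 : ℝ) < ∞ :=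
    lt_of_le_of_lt (setLIntegral_rpow_le_measure_add volume _ (fun z : ℝ × ℝ³ => ‖p z.1 z.2‖ₑ)
      (by norm_num) (by norm_num))
      (ENNReal.add_lt_top.2 ⟨volume_parabolicCylinder_lt_top ρ _, hp53⟩)
  have hnull := h42 hν hρ hsuit ⟨C₀, ae_of_all _ hC₀'⟩ ⟨G, hG, hGint⟩ hp32
  -- Step 3: Tsai's contradiction argument.
  by_contra hcon
  push Not at hcon
  choose y hyR hyC using fun k : ℕ => hcon k (k + 1)
  have hy0 : ∀ k, 0 < ‖y k‖ := fun k => lt_of_lt_of_le (by positivity) (hyR k)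
  have hd1 : ∀ k, ‖y k‖⁻¹ • y k ∈ sphere (0 : ℝ³) 1 := fun k => by
    rw [mem_sphere_zero_iff_norm]
    exact norm_smul_inv_norm (norm_pos_iff.1 (hy0 k))
  obtain ⟨xs, hxs, φ, hφ, hlim⟩ := (isCompact_sphere (0 : ℝ³) 1).tendsto_subseq hd1
  have hxs1 : ‖xs‖ = 1 := mem_sphere_zero_iff_norm.1 hxs
  have hnorm : Tendsto (fun n => ‖y (φ n)‖) atTop atTop := by
    refine tendsto_atTop_mono (fun n => ?_) tendsto_natCast_atTop_atTop
    calc (n : ℝ) ≤ φ n := Nat.cast_le.2 (hφ.id_le n)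
      _ ≤ φ n + 1 := by linarith
      _ ≤ ‖y (φ n)‖ := hyR (φ n)
  -- every point `σ • xs`, `0 < σ < ρ`, of the segment is a singular point at the top time `T`
  have hseg : ∀ σ ∈ Ioo (0 : ℝ) ρ, IsBackwardSingularPoint (FluidPDE.lerayBackward a T U) (T, σ • xs) := by
    intro σ hσ
    apply isBackwardSingularPoint_of_forall_exists_continuousAt
    intro r hr M
    have h1 : ∀ᶠ n in atTop, ‖‖y (φ n)‖⁻¹ • y (φ n) - xs‖ < r / σ := by
      have ht := tendsto_iff_norm_sub_tendsto_zero.1 hlim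
      exact (tendsto_order.1 ht).2 _ (div_pos hr hσ.1)
    have h2 : ∀ᶠ n in atTop, (2 * a * (‖y (φ n)‖ / σ) ^ 2)⁻¹ < r ^ 2 := by
      have ht : Tendsto (fun n => (2 * a * (‖y (φ n)‖ / σ) ^ 2)⁻¹) atTop (𝓝 0) := by
        refine tendsto_inv_atTop_zero.comp ?_
        refine Tendsto.const_mul_atTop (by positivity) ?_
        exact (tendsto_pow_atTop two_ne_zero).comp (hnorm.atTop_div_const hσ.1)
      exact (tendsto_order.1 ht).2 _ (by positivity)
    have h3 : ∀ᶠ n : ℕ in atTop, M * σ ≤ n := by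
      obtain ⟨N, hN⟩ := exists_nat_ge (M * σ)
      exact eventually_atTop.2 ⟨N, fun n hn => hN.trans (Nat.cast_le.2 hn)⟩
    obtain ⟨n, hn1, hn2, hn3⟩ := (h1.and (h2.and h3)).exists
    have hLpos : 0 < ‖y (φ n)‖ / σ := div_pos (hy0 _) hσ.1
    refine ⟨(T - (2 * a * (‖y (φ n)‖ / σ) ^ 2)⁻¹, (‖y (φ n)‖ / σ)⁻¹ • y (φ n)), ?_, ?_, ?_⟩
    · -- the point lies in `Q_r(T, σ • xs)`
      have hx : (‖y (φ n)‖ / σ)⁻¹ • y (φ n) = σ • (‖y (φ n)‖⁻¹ • y (φ n)) := by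
        rw [smul_smul, inv_div, div_eq_mul_inv]
      simp only [FluidPDE.mem_parabolicCylinder]
      refine ⟨⟨by linarith, sub_lt_self _ (by positivity)⟩, ?_⟩
      rw [hx, dist_eq_norm, ← smul_sub, norm_smul, Real.norm_of_nonneg hσ.1.le]
      calc σ * ‖‖y (φ n)‖⁻¹ • y (φ n) - xs‖ < σ * (r / σ) := mul_lt_mul_of_pos_left hn1 hσ.1
        _ = r := mul_div_cancel₀ _ hσ.1.ne'
    · -- `u` is continuous there (the time is `< T`)
      exact continuousAt_uncurry_lerayBackward ha hprof.contDiff_velocity.continuous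
        (sub_lt_self _ (by positivity))
    · -- and `|u| = |yₖ| |U(yₖ)| / σ > k / σ ≥ M` there
      show M < ‖FluidPDE.lerayBackward a T U (T - (2 * a * (‖y (φ n)‖ / σ) ^ 2)⁻¹)
        ((‖y (φ n)‖ / σ)⁻¹ • y (φ n))‖
      rw [lerayBackward_apply_of_scale ha hLpos, smul_smul, mul_inv_cancel₀ hLpos.ne', one_smul,
        norm_smul, Real.norm_of_nonneg hLpos.le, div_mul_eq_mul_div, lt_div_iff₀ hσ.1]
      calc M * σ ≤ n := hn3
        _ ≤ φ n := Nat.cast_le.2 (hφ.id_le n)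
        _ < ‖y (φ n)‖ * ‖U (y (φ n))‖ := hyC (φ n)
  -- Step 4: the segment has `μH[1]`-measure `ρ > 0`, contradicting Step 2.
  have hsub : (fun σ : ℝ => σ • xs) '' Ioo (0 : ℝ) ρ ⊆
      {x ∈ ball (0 : ℝ³) ρ | IsBackwardSingularPoint (FluidPDE.lerayBackward a T U) (T, x)} := by
    rintro _ ⟨σ, hσ, rfl⟩
    refine ⟨?_, hseg σ hσ⟩
    rw [mem_ball_zero_iff, norm_smul, Real.norm_of_nonneg hσ.1.le, hxs1, mul_one]
    exact hσ.2
  have hmeas : μH[1] ((fun σ : ℝ => σ • xs) '' Ioo (0 : ℝ) ρ) = ENNReal.ofReal ρ := by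
    have hnn : ‖xs‖₊ = 1 := by
      ext
      rw [coe_nnnorm, hxs1, NNReal.coe_one]
    rw [hausdorffMeasure_smul_right_image, hausdorffMeasure_real, Real.volume_Ioo, sub_zero, hnn,
      one_smul]
  have hle := measure_mono (μ := μH[1]) hsub
  rw [hnull, hmeas, nonpos_iff_eq_zero, ENNReal.ofReal_eq_zero] at hle
  exact absurd hle (not_le.2 hρ)

/-- **Tsai 1998, Theorem 2 from Theorem 1** (p. 47, "The first way is to observe that, since `U`
is smooth, `U ∈ L^q(ℝ³)` for `q > 3` by Lemma 4.1 and Corollary 4.3. Therefore Theorem 2 follows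
from Theorem 1"): the vendored `tsai_selfsimilar_local_energy` follows from the vendored
Theorem 1 (`tsai_selfsimilar`), Lemma 4.1 (`tsai1998_lemma41`) and the top-regularity
consequence of Lemma 4.2 (`tsai1998_top_singular_null`), via `tsai1998_corollary43` and
`memLp_of_norm_mul_norm_le` (with `q = 4`). [cite: Tsai1998, proof of Theorem 2 (p. 47)] -/
theorem tsai_selfsimilar_local_energy_of_tsai_selfsimilar (h1 : tsai_selfsimilar)
    (h41 : tsai1998_lemma41) (h42 : tsai1998_top_singular_null) :
    tsai_selfsimilar_local_energy := by
  intro ν a T t₀ hν ha ht₀ U P hprof henergy hgrad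
  obtain ⟨C, R, hdecay⟩ := tsai1998_corollary43 h41 h42 hν ha ht₀ hprof henergy hgrad
  have hU : MemLp U 4 volume :=
    memLp_of_norm_mul_norm_le hprof.contDiff_velocity.continuous hdecay (by norm_num)
      (ENNReal.ofNat_lt_top)
  exact h1 hν ha hprof (by norm_num) ENNReal.ofNat_lt_top hU


/-! ## Lemma 4.2 itself, and the covering argument for the top of a cylinder

`tsai1998_top_singular_null` is the *consequence* Tsai draws from his Lemma 4.2; here the lemma
itself (the backward ε-regularity criterion) is vendored and the consequence is **proved** from it
by the covering argument of Caffarelli–Kohn–Nirenberg 1982, proof of Theorem B (p. 807), at the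
fixed top time `T`: if `x` is a singular point at the top, `limsup_{r→0} r⁻¹ ∫∫_{Q_r(T,x)} |∇u|² > ε`,
so for every `δ > 0` there are arbitrarily small `r ≤ δ` with `∫∫_{Q_r(T,x)} |∇u|² ≥ ε r`; by
Vitali's covering lemma in `ℝ³` (all cylinders share the top time, so disjointness of
`Q_r(T, x) = (T - r², T) × B_r(x)` is disjointness of the balls) a disjoint subfamily
`{B_{rᵢ}(xᵢ)}` has `S ⊆ ⋃ᵢ B̄_{4rᵢ}(xᵢ)`, whence
`𝓗¹_{8δ}(S) ≤ Σᵢ 8rᵢ ≤ (8/ε) Σᵢ ∫∫_{Q_{rᵢ}(T,xᵢ)} |∇u|² ≤ (8/ε) ∫∫_{Q_ρ ∩ {t > T - δ²}} |∇u|² → 0`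
as `δ → 0` (`∇u ∈ L²(Q_ρ)`). -/

/-- **Tsai 1998, Lemma 4.2** (p. 46; "a variant of Proposition 2 of [CKN]": "Let `(u, p)` be a
suitable weak solution of (1.1). There is an absolute constant `ε₄ > 0` such that, if
`limsup_{r → 0⁺} r⁻¹ ∫_{Q_r(x,t)} |∇u|² ≤ ε₄`, then `u` is essentially bounded in `Q_{r₁}(x, t)` for
some `r₁ > 0`. This lemma differs from Proposition 2 of [CKN] by replacing `Q*_r(x, t)` by
`Q_r(x, t)` … It assumes the information only at times previous to `t`, and gets control only at
times previous to `t`. Since the original proof of Proposition 2 of [CKN] and the accompanying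
lemmas go through without change, we omit the details"). Rendering: for every viscosity `ν > 0`
there is `ε > 0` (Tsai's (1.1) carries `ν`; for `ν = 1` the constant is absolute) such that for
every suitable weak solution `(u, p)` (zero force) on a cylinder `Q_ρ(x₀, T)` lying in CKN's
class on the whole cylinder (as in `tsai1998_top_singular_null`: `u ∈ L^∞_t L²_x`, a weak spatial
gradient `G` with `∫∫_{Q_ρ} |G|² < ∞`, `p ∈ L^{3/2}(Q_ρ)`), and every point `z = (t, x)` with
`x ∈ B_ρ(x₀)` and `T - ρ² < t ≤ T` (so that the small backward cylinders `Q_r(z)` lie in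
`Q_ρ(x₀, T)`; `t = T` is the top), `limsup_{r → 0⁺} r⁻¹ ∫∫_{Q_r(z)} |G|² ≤ ε` implies that `u` is
essentially bounded on `Q_{r₁}(z)` for some `r₁ > 0`. [cite: Tsai1998, Lemma 4.2 (p. 46)] -/
def tsai1998_lemma42 : Prop :=
  ∀ ν : ℝ, 0 < ν → ∃ ε : ℝ, 0 < ε ∧
    ∀ (ρ T : ℝ) (x₀ : ℝ³) (u : ℝ → ℝ³ → ℝ³) (p : ℝ → ℝ³ → ℝ) (G : ℝ → ℝ³ → ℝ³ →L[ℝ] ℝ³),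
      0 < ρ →
      FluidPDE.IsSuitableWeakSolutionOn (FluidPDE.parabolicCylinderOpens ρ (T, x₀)) ν 0 u p →
      (∃ C : ℝ≥0, ∀ᵐ t : ℝ, t ∈ Ioo (T - ρ ^ 2) T → ∫⁻ x in ball x₀ ρ, ‖u t x‖ₑ ^ 2 ≤ C) →
      FluidPDE.HasWeakSpatialGradientOn (FluidPDE.parabolicCylinderOpens ρ (T, x₀)) u G →
      ∫⁻ z in FluidPDE.parabolicCylinder ρ (T, x₀),
          ENNReal.ofReal (FluidPDE.frobeniusNormSq (G z.1 z.2)) < ∞ →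
      ∫⁻ z in FluidPDE.parabolicCylinder ρ (T, x₀), ‖p z.1 z.2‖ₑ ^ (3 / 2 : ℝ) < ∞ →
      ∀ z : ℝ × ℝ³, z.1 ∈ Ioc (T - ρ ^ 2) T → z.2 ∈ ball x₀ ρ →
        limsup (fun r : ℝ => (ENNReal.ofReal r)⁻¹ *
            ∫⁻ w in FluidPDE.parabolicCylinder r z,
              ENNReal.ofReal (FluidPDE.frobeniusNormSq (G w.1 w.2))) (𝓝[>] (0 : ℝ)) ≤
          ENNReal.ofReal ε →
        ∃ r₁ : ℝ, 0 < r₁ ∧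
          eLpNorm (uncurry u) ∞ (volume.restrict (FluidPDE.parabolicCylinder r₁ z)) < ∞

/-- The diameter of a closed ball of radius `R ≥ 0` in `ℝ³` is at most `2R` (in `ℝ≥0∞`). [folklore] -/
theorem ediam_closedBall_le_ofReal (x : ℝ³) {R : ℝ} (_hR : 0 ≤ R) :
    Metric.ediam (closedBall x R) ≤ ENNReal.ofReal (2 * R) := by
  refine Metric.ediam_le_of_forall_dist_le fun a ha b hb => ?_
  rw [mem_closedBall] at ha hb
  calc dist a b ≤ dist a x + dist b x := dist_triangle_right _ _ _
    _ ≤ R + R := add_le_add ha hb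
    _ = 2 * R := by ring

/-- Backward cylinders with the same top time and disjoint closed base balls are disjoint. [folklore] -/
theorem disjoint_parabolicCylinder_of_disjoint_closedBall {T r₁ r₂ : ℝ} {x₁ x₂ : ℝ³}
    (h : Disjoint (closedBall x₁ r₁) (closedBall x₂ r₂)) :
    Disjoint (FluidPDE.parabolicCylinder r₁ (T, x₁)) (FluidPDE.parabolicCylinder r₂ (T, x₂)) := by
  rw [FluidPDE.parabolicCylinder, FluidPDE.parabolicCylinder, Set.disjoint_prod]
  exact Or.inr (h.mono ball_subset_closedBall ball_subset_closedBall)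

/-- **The covering argument at the top of a cylinder** (Caffarelli–Kohn–Nirenberg 1982, proof of
Theorem B, p. 807, as invoked by Tsai 1998 after Lemma 4.2): the backward ε-regularity criterion
`tsai1998_lemma42` implies that the singular set at the top of the cylinder is `μH[1]`-null,
i.e. `tsai1998_top_singular_null` (see the section docstring for the argument: Vitali covering by
the base balls, `Σ rᵢ ≤ ε⁻¹ ∫∫_{Q_ρ ∩ {t > T - δ²}} |∇u|² → 0`). [cite: Tsai1998, remark after Lemma 4.2 (p. 46)] -/
theorem tsai1998_top_singular_null_of_lemma42 (h42 : tsai1998_lemma42) :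
    tsai1998_top_singular_null := by
  intro ν ρ T x₀ hν hρ u p hsuit henergy hgrad hp
  obtain ⟨ε, hε, H⟩ := h42 ν hν
  obtain ⟨G, hG, hGint⟩ := hgrad
  set Q : Set (ℝ × ℝ³) := FluidPDE.parabolicCylinder ρ (T, x₀) with hQ
  set F : ℝ × ℝ³ → ℝ≥0∞ := fun w => ENNReal.ofReal (FluidPDE.frobeniusNormSq (G w.1 w.2)) with hF
  set S : Set ℝ³ := {x ∈ ball x₀ ρ | IsBackwardSingularPoint u (T, x)} with hS
  have hQmeas : MeasurableSet Q := measurableSet_Ioo.prod measurableSet_ball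
  -- the finite measure `|∇u|² dx dt` on the cylinder
  set μ : Measure (ℝ × ℝ³) := (volume.restrict Q).withDensity F with hμ
  haveI : IsFiniteMeasure μ := by
    refine isFiniteMeasure_withDensity ?_
    exact hGint.ne
  have hμ_apply : ∀ {B : Set (ℝ × ℝ³)}, MeasurableSet B → B ⊆ Q → μ B = ∫⁻ w in B, F w := by
    intro B hB hBQ
    rw [hμ, withDensity_apply _ hB, Measure.restrict_restrict hB, inter_eq_left.2 hBQ]
  -- Step 1: at a singular top point, arbitrarily small cylinders carry `≥ ε r` of dissipation.
  have key : ∀ x ∈ S, ∀ δ : ℝ, 0 < δ → ∃ r : ℝ, 0 < r ∧ r ≤ δ ∧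
      closedBall x r ⊆ ball x₀ ρ ∧ r ≤ ρ ∧
      ENNReal.ofReal (ε * r) ≤ μ (FluidPDE.parabolicCylinder r (T, x)) := by
    intro x hx δ hδ
    have hxball : x ∈ ball x₀ ρ := hx.1
    have hlim : ENNReal.ofReal ε < limsup (fun r : ℝ => (ENNReal.ofReal r)⁻¹ *
        ∫⁻ w in FluidPDE.parabolicCylinder r (T, x), F w) (𝓝[>] (0 : ℝ)) := by
      by_contra hle
      push Not at hle
      obtain ⟨r₁, hr₁, hbd⟩ := H ρ T x₀ u p G hρ hsuit henergy hG hGint hp (T, x)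
        ⟨by simp only; nlinarith [hρ], le_rfl⟩ hxball hle
      exact absurd (hx.2 r₁ hr₁) hbd.ne
    have hfreq := frequently_lt_of_lt_limsup (by isBoundedDefault) hlim
    have hgap : 0 < ρ - dist x x₀ := sub_pos.2 (mem_ball.1 hxball)
    have hev : ∀ᶠ r in 𝓝[>] (0 : ℝ), 0 < r ∧ r ≤ δ ∧ closedBall x r ⊆ ball x₀ ρ ∧ r ≤ ρ := by
      filter_upwards [Ioo_mem_nhdsGT (lt_min hδ hgap)] with r hr
      refine ⟨hr.1, (hr.2.le.trans (min_le_left _ _)), ?_, ?_⟩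
      · exact closedBall_subset_ball' (by linarith [hr.2.trans_le (min_le_right δ _)])
      · linarith [hr.2.trans_le (min_le_right δ _), dist_nonneg (x := x) (y := x₀)]
    obtain ⟨r, ⟨hr0, hrδ, hrball, hrρ⟩, hr⟩ := (hev.and_frequently hfreq).exists
    refine ⟨r, hr0, hrδ, hrball, hrρ, ?_⟩
    have hsubQ : FluidPDE.parabolicCylinder r (T, x) ⊆ Q := by
      rw [hQ, FluidPDE.parabolicCylinder, FluidPDE.parabolicCylinder]
      exact prod_mono (Ioo_subset_Ioo_left (by nlinarith)) (ball_subset_closedBall.trans hrball)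
    rw [hμ_apply (FluidPDE.isOpen_parabolicCylinder r _).measurableSet hsubQ]
    rw [← ENNReal.div_eq_inv_mul, ENNReal.lt_div_iff_mul_lt (Or.inl (ENNReal.ofReal_pos.2 hr0).ne')
      (Or.inl ENNReal.ofReal_ne_top), ← ENNReal.ofReal_mul hε.le] at hr
    exact hr.le
  -- Step 2: for every `δ > 0`, a countable cover of `S` by closed balls of radii `≤ 4δ` whose radii
  -- sum to at most `ε⁻¹ μ(Q ∩ {t > T - δ²})`.
  have cover : ∀ δ : ℝ, 0 < δ → ∃ (ι : Type) (_ : Countable ι) (t : ι → Set ℝ³),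
      (∀ i, Metric.ediam (t i) ≤ ENNReal.ofReal (8 * δ)) ∧ S ⊆ ⋃ i, t i ∧
      ∑' i, Metric.ediam (t i) ≤ ENNReal.ofReal (8 / ε) * μ (Ioi (T - δ ^ 2) ×ˢ univ) := by
    intro δ hδ
    choose! r hr using key
    obtain ⟨U, hUS, hdisj, hcov⟩ := Vitali.exists_disjoint_subfamily_covering_enlargement_closedBall
      S id (fun x => r x δ) δ (fun a ha => (hr a ha δ hδ).2.1) 4 (by norm_num)
    have hUc : U.Countable := by
      refine hdisj.countable_of_nonempty_interior fun b hb => ⟨b, ?_⟩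
      exact ball_subset_interior_closedBall (mem_ball_self (hr b (hUS hb) δ hδ).1)
    haveI : Countable U := hUc.to_subtype
    refine ⟨U, inferInstance, fun b => closedBall (b : ℝ³) (4 * r b δ), fun b => ?_, ?_, ?_⟩
    · -- diameters
      have hb := hr b (hUS b.2) δ hδ
      calc Metric.ediam (closedBall (b : ℝ³) (4 * r b δ)) ≤ ENNReal.ofReal (2 * (4 * r b δ)) :=
            ediam_closedBall_le_ofReal _ (by linarith [hb.1])
        _ ≤ ENNReal.ofReal (8 * δ) := ENNReal.ofReal_le_ofReal (by linarith [hb.2.1])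
    · -- cover
      intro a ha
      obtain ⟨b, hbU, hab⟩ := hcov a ha
      exact mem_iUnion.2 ⟨⟨b, hbU⟩, hab (mem_closedBall_self (hr a ha δ hδ).1.le)⟩
    · -- the sum of the radii
      have hsub : ∀ b : U, FluidPDE.parabolicCylinder (r b δ) (T, (b : ℝ³)) ⊆ Ioi (T - δ ^ 2) ×ˢ univ := by
        intro b w hw
        have hb := hr b (hUS b.2) δ hδ
        rw [FluidPDE.mem_parabolicCylinder] at hw
        refine ⟨?_, mem_univ _⟩
        have : r b δ ^ 2 ≤ δ ^ 2 := pow_le_pow_left₀ hb.1.le hb.2.1 2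
        simp only [mem_Ioi]
        linarith [hw.1.1]
      have hdisj' : Pairwise (Disjoint on fun b : U => FluidPDE.parabolicCylinder (r b δ) (T, (b : ℝ³))) := by
        intro b₁ b₂ hne
        have hne' : (b₁ : ℝ³) ≠ b₂ := fun h => hne (Subtype.ext h)
        exact disjoint_parabolicCylinder_of_disjoint_closedBall (hdisj b₁.2 b₂.2 hne')
      calc ∑' b : U, Metric.ediam (closedBall (b : ℝ³) (4 * r b δ))
          ≤ ∑' b : U, ENNReal.ofReal (8 / ε) * μ (FluidPDE.parabolicCylinder (r b δ) (T, (b : ℝ³))) := by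
            refine ENNReal.tsum_le_tsum fun b => ?_
            have hb := hr b (hUS b.2) δ hδ
            calc Metric.ediam (closedBall (b : ℝ³) (4 * r b δ))
                ≤ ENNReal.ofReal (2 * (4 * r b δ)) := ediam_closedBall_le_ofReal _ (by linarith [hb.1])
              _ = ENNReal.ofReal (8 / ε) * ENNReal.ofReal (ε * r b δ) := by
                  rw [← ENNReal.ofReal_mul (by positivity)]
                  congr 1
                  field_simp
                  ring
              _ ≤ ENNReal.ofReal (8 / ε) * μ (FluidPDE.parabolicCylinder (r b δ) (T, (b : ℝ³))) :=
                  mul_le_mul_right hb.2.2.2.2 _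
        _ = ENNReal.ofReal (8 / ε) * μ (⋃ b : U, FluidPDE.parabolicCylinder (r b δ) (T, (b : ℝ³))) := by
            rw [ENNReal.tsum_mul_left, measure_iUnion hdisj'
              (fun b => (FluidPDE.isOpen_parabolicCylinder _ _).measurableSet)]
        _ ≤ ENNReal.ofReal (8 / ε) * μ (Ioi (T - δ ^ 2) ×ˢ univ) :=
            mul_le_mul_right (measure_mono (iUnion_subset hsub)) _
  -- Step 3: `μH[1](S) ≤ liminf_n (8/ε) μ(Q ∩ {t > T - δₙ²}) = 0`, `δₙ = (n + 1)⁻¹`.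
  set δs : ℕ → ℝ := fun n => ((n : ℝ) + 1)⁻¹ with hδs
  have hδpos : ∀ n, 0 < δs n := fun n => by positivity
  choose ι hι t hdiam hcov hsum using fun n : ℕ => cover (δs n) (hδpos n)
  have hδlim : Tendsto δs atTop (𝓝 0) := tendsto_one_div_add_atTop_nhds_zero_nat.congr fun n => by
    simp [hδs]
  have hbound : μH[1] S ≤ liminf (fun n => ∑' i, Metric.ediam (t n i) ^ (1 : ℝ)) atTop := by
    haveI := hι
    refine Measure.hausdorffMeasure_le_liminf_tsum 1 S (fun n => ENNReal.ofReal (8 * δs n)) ?_ t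
      (Eventually.of_forall hdiam) (Eventually.of_forall hcov)
    rw [← ENNReal.ofReal_zero]
    exact ENNReal.tendsto_ofReal (by simpa using hδlim.const_mul 8)
  set A : ℕ → Set (ℝ × ℝ³) := fun n => Ioi (T - δs n ^ 2) ×ˢ univ with hA
  have hAanti : Antitone A := by
    intro m n hmn
    refine prod_mono (Ioi_subset_Ioi ?_) Subset.rfl
    have h1 : δs n ≤ δs m := by
      simp only [hδs]
      exact inv_anti₀ (by positivity) (by exact_mod_cast Nat.succ_le_succ hmn |>.trans_eq rfl)
    nlinarith [hδpos n, hδpos m]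
  have hAlim : Tendsto (fun n => μ (A n)) atTop (𝓝 (μ (⋂ n, A n))) :=
    tendsto_measure_iInter_atTop (fun n => (measurableSet_Ioi.prod MeasurableSet.univ).nullMeasurableSet)
      hAanti ⟨0, measure_ne_top μ _⟩
  have hAempty : μ (⋂ n, A n) = 0 := by
    have hmeasI : MeasurableSet (⋂ n, A n) :=
      MeasurableSet.iInter fun n => measurableSet_Ioi.prod MeasurableSet.univ
    rw [hμ, withDensity_apply _ hmeasI, Measure.restrict_restrict hmeasI]
    have hempty : (⋂ n, A n) ∩ Q = ∅ := by
      ext w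
      simp only [mem_inter_iff, mem_iInter, mem_empty_iff_false, iff_false, not_and]
      intro hw hwQ
      rw [hQ, FluidPDE.mem_parabolicCylinder] at hwQ
      have hgap : 0 < T - w.1 := sub_pos.2 hwQ.1.2
      obtain ⟨n, hn⟩ := exists_nat_one_div_lt hgap
      have hwn := (hw n).1
      simp only [mem_Ioi] at hwn
      have hδ1 : δs n ≤ 1 := by
        simp only [hδs]
        exact inv_le_one_of_one_le₀ (by linarith [n.cast_nonneg (α := ℝ)])
      have hsq : δs n ^ 2 ≤ δs n := by nlinarith [hδpos n]
      have : δs n < T - w.1 := by simpa [hδs, one_div] using hn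
      linarith
    rw [hempty, Measure.restrict_empty, lintegral_zero_measure]
  have hlim2 : Tendsto (fun n => ENNReal.ofReal (8 / ε) * μ (A n)) atTop (𝓝 0) := by
    have := ENNReal.Tendsto.const_mul hAlim (Or.inr ENNReal.ofReal_ne_top) (a := ENNReal.ofReal (8 / ε))
    rwa [hAempty, mul_zero] at this
  refine le_antisymm ?_ (zero_le)
  calc μH[1] S ≤ liminf (fun n => ∑' i, Metric.ediam (t n i) ^ (1 : ℝ)) atTop := hbound
    _ ≤ liminf (fun n => ENNReal.ofReal (8 / ε) * μ (A n)) atTop := by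
        refine liminf_le_liminf (Eventually.of_forall fun n => ?_)
        simp only [ENNReal.rpow_one]
        exact hsum n
    _ = 0 := hlim2.liminf_eq

/-- Hence Theorem 2 also follows from Theorem 1, Lemma 4.1 and Lemma 4.2 proper (Tsai 1998,
p. 47, "the first way", with the covering step `tsai1998_top_singular_null_of_lemma42`). [cite: Tsai1998, proof of Theorem 2 (p. 47)] -/
theorem tsai_selfsimilar_local_energy_of_lemmas (h1 : tsai_selfsimilar) (h41 : tsai1998_lemma41)
    (h42 : tsai1998_lemma42) : tsai_selfsimilar_local_energy :=
  tsai_selfsimilar_local_energy_of_tsai_selfsimilar h1 h41 (tsai1998_top_singular_null_of_lemma42 h42)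

end Literature.Analysis.FluidPDE
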